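import Literature.NumberTheory.LFunctions.ConreyIwaniec2002PerSegmentEstimate
import Literature.NumberTheory.LFunctions.ConreyIwaniec2002DyadicUnion
import Literature.NumberTheory.LFunctions.DirichletLDerivativeExplicitBound
import Literature.NumberTheory.LFunctions.DirichletLOneLogBound
import HarnessLib

/-!
# Conrey–Iwaniec (2002), §9: Proposition 9.1 ⟹ Proposition 9.2 (the principal estimate (9.12))

Conrey–Iwaniec, *Spacing of zeros of Hecke L-functions and the class number problem*, Acta Arith.
103 (2002), §9, p. 20 [held text `paper:arxiv-math_0111012`, p0020:L45–98]: the per-segment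
estimate (`ConreyIwaniec2002PerSegmentEstimate.lean`) summed over the dyadic segments
`2^ν < t ≤ 2^{ν+1}` (tree `dyadic_union`) gives (9.12).

PROVED HERE (no named fact introduced):
* `conreyIwaniec2002_proposition92_of_proposition91` — the typed Proposition 9.2
  (`conreyIwaniec2002_proposition92`, AS PRINTED, middle term `T(log T)L(1,χ)^{1/2}(log q)^3`)
  from the typed Proposition 9.1 (`conreyIwaniec2002_proposition91`, consumed only for
  `T ≥ q^65`, `log T ≥ (log q)²`, the range of its printed proof) AND the printed cosmetic claim of
  (9.11) taken as an explicit hypothesis `hLq`: "if `(log T)L(1,χ)^{1/2}(log q)^3 ≤ 1` then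
  `ℒ(T) ≪ L(1,χ) log q`". HONEST LABEL: with `ℒ(T) = L(1,χ)(L(1,χ)log T + |L′(1,χ)|)` (6.50) this
  is `|L′(1,χ)| ≪ log q` for real primitive `χ` with `L(1,χ) ≤ (log q)^{−6}(log T)^{−2}` — an
  exceptional-character-regime bound that is NOT in print and is OPEN (equivalent to
  `1 − β₁ ≫ L(1,χ)/log q`; best known `L(1,χ) ≪ (1−β₁)(log q)²/log η`, Friedlander–Iwaniec,
  Expo. Math. 36 (2018), arXiv:1701.03771, (1.4), Thm 2, (3.7); Montgomery–Vaughan MNT I Thm 11.4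
  (11.8)/(11.10), Ex. 11.2.1.3). `hLq` is vacuous unless `χ` is a near-Siegel-zero character.
* `conreyIwaniec2002_proposition92_weak_of_proposition91` — the FACT-FREE variant from the typed
  Proposition 9.1 alone: (9.12) with middle term `T(log T)L(1,χ)^{1/2}(log q)^{7/2}`, the
  cosmetic step replaced by the textbook `|L′(1,χ)| ≪ (log q)²` (tree
  `DirichletAbel.norm_deriv_LFunction_ofReal_le`) and `L(1,χ) ≤ log q` (tree
  `DirichletAbel.norm_LFunction_one_le_log`): `calL_le_of_small_weak`.

## References

* [ConreyIwaniec2002] B. Conrey, H. Iwaniec, Acta Arith. 103 (2002) 259–312, arXiv:math/0111012: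
  §9 (9.6)–(9.12), Propositions 9.1 and 9.2.
* [FriedlanderIwaniec2018] J. Friedlander, H. Iwaniec, *A note on Dirichlet L-functions*, Expo.
  Math. 36 (2018) 343–350, arXiv:1701.03771 (status of the bound behind (9.11)).
-/

noncomputable section

open scoped NumberField
open Complex

namespace Literature.NumberTheory.LFunctions

namespace ConreyIwaniec2002

open NumberField

/-! ### The dyadic union -/

/-- **The principal estimate with exponent `e` from the per-segment form**, by the dyadic union
(tree `dyadic_union`). [cite: ConreyIwaniec2002, §9 (before Proposition 9.2)] -/
theorem principalEstimate_of (e : ℝ)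
    (h1 : ∃ C : ℝ, 0 < C ∧
      ∀ (q : ℕ) [NeZero q], 4 < q → Odd q → ∀ χ : DirichletCharacter ℂ q,
        χ.IsPrimitive → χ.IsQuadratic → χ.Odd →
          ∀ (K : Type) [Field K] [NumberField K],
            Module.finrank ℚ K = 2 → NumberField.discr K = -(q : ℤ) →
              ∀ (ψ : ClassGroup (𝓞 K) →* ℂˣ) (T : ℝ) (S : Finset ℝ) (t' : ℝ → ℝ),
                (q : ℝ) ^ (65 : ℕ) ≤ T → Real.exp (Real.log q ^ (2 : ℕ)) ≤ T →
                  IsDyadicPointSet S T →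
                  defectE K ψ q S t' ≤
                    C * (T * Real.log q ^ (6 : ℕ) +
                      T * Real.sqrt (calL χ T) * Real.log T ^ (2 : ℕ) * Real.log q ^ ((5 : ℝ) / 2)))
    (h4 : ∃ C : ℝ, 0 < C ∧
      ∀ (q : ℕ) [NeZero q], 4 < q → ∀ χ : DirichletCharacter ℂ q,
        χ.IsPrimitive → χ.IsQuadratic → χ.Odd → ∀ T : ℝ, 2 ≤ T →
          Real.log T * Real.sqrt ‖χ.LFunction 1‖ * Real.log q ^ e ≤ 1 →
            calL χ T ≤ C * (‖χ.LFunction 1‖ * Real.log q ^ (2 * e - 5))) :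
    ∃ C : ℝ, 0 < C ∧
    ∀ (q : ℕ) [NeZero q], 4 < q → Odd q → ∀ χ : DirichletCharacter ℂ q,
      χ.IsPrimitive → χ.IsQuadratic → χ.Odd →
        ∀ (K : Type) [Field K] [NumberField K],
          Module.finrank ℚ K = 2 → NumberField.discr K = -(q : ℤ) →
            ∀ (ψ : ClassGroup (𝓞 K) →* ℂˣ) (T : ℝ) (S : Finset ℝ) (t' : ℝ → ℝ),
              2 ≤ T → IsPointSet S T →
                ∑ t ∈ S, sincTerm t (t' t) ≤
                  C * (T / Real.log T * Real.log q ^ (6 : ℕ) +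
                    T * Real.log T * Real.sqrt ‖χ.LFunction 1‖ * Real.log q ^ e +
                    Real.log q ^ ((5 : ℝ) / 2) / Real.log T *
                      Real.sqrt (T * ∑ t ∈ S, ‖dividedDifference (classGroupLFunction K ψ)
                        (1 / 2 + t * I) (1 / 2 + t' t * I)‖ ^ 2)) := by
  classical
  obtain ⟨C₀, hC₀, hseg⟩ := perSegmentBound_of e h1 h4
  obtain ⟨C', hC', h⟩ := dyadic_union C₀ hC₀
  refine ⟨C', hC', fun q _ hq hodd χ hprim hquad hoddχ K _ _ hK hdisc ψ T S t' hT hS => ?_⟩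
  have hq5 : (5 : ℝ) ≤ q := by exact_mod_cast hq
  have hℓ1 : 1 < Real.log q := by
    rw [Real.lt_log_iff_exp_lt (by linarith)]
    exact Real.exp_one_lt_d9.trans_le (by linarith)
  have hA : (1 : ℝ) ≤ Real.log q ^ (6 : ℕ) := one_le_pow₀ hℓ1.le
  have hB : (0 : ℝ) ≤ Real.sqrt ‖χ.LFunction 1‖ * Real.log q ^ e := by
    have := Real.rpow_nonneg (by linarith : (0 : ℝ) ≤ Real.log q) e
    positivity
  have hE : (0 : ℝ) ≤ Real.log q ^ ((5 : ℝ) / 2) := by positivity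
  have key := h (Real.log q ^ (6 : ℕ)) (Real.sqrt ‖χ.LFunction 1‖ * Real.log q ^ e)
    (Real.log q ^ ((5 : ℝ) / 2)) T S (fun t => sincTerm t (t' t))
    (fun t => ‖dividedDifference (classGroupLFunction K ψ) (1 / 2 + t * I) (1 / 2 + t' t * I)‖ ^ 2)
    hA hB hE hT hS (fun t => sincTerm_nonneg t (t' t)) (fun t => sincTerm_le_one t (t' t))
    (fun t => by positivity)
    (fun T₀ S₀ hT₀ _ hS₀ => by
      have := hseg q hq hodd χ hprim hquad hoddχ K hK hdisc ψ T₀ S₀ t' hT₀ hS₀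
      convert this using 2
      ring)
  convert key using 2
  ring

end ConreyIwaniec2002

open ConreyIwaniec2002 NumberField

/-! ### The restricted Proposition 9.1 from the typed fact -/

/-- The doubly restricted form of Proposition 9.1 consumed above (`T ≥ q^65`, `log T ≥ (log q)²`,
the range of the printed proof) follows from the typed `conreyIwaniec2002_proposition91`.
[cite: ConreyIwaniec2002, Proposition 9.1 (9.7)] -/
theorem ConreyIwaniec2002.prop91_large_of_proposition91 (h : conreyIwaniec2002_proposition91) :
    ∃ C : ℝ, 0 < C ∧
    ∀ (q : ℕ) [NeZero q], 4 < q → Odd q → ∀ χ : DirichletCharacter ℂ q,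
      χ.IsPrimitive → χ.IsQuadratic → χ.Odd →
        ∀ (K : Type) [Field K] [NumberField K],
          Module.finrank ℚ K = 2 → NumberField.discr K = -(q : ℤ) →
            ∀ (ψ : ClassGroup (𝓞 K) →* ℂˣ) (T : ℝ) (S : Finset ℝ) (t' : ℝ → ℝ),
              (q : ℝ) ^ (65 : ℕ) ≤ T → Real.exp (Real.log q ^ (2 : ℕ)) ≤ T →
                IsDyadicPointSet S T →
                defectE K ψ q S t' ≤
                  C * (T * Real.log q ^ (6 : ℕ) +
                    T * Real.sqrt (calL χ T) * Real.log T ^ (2 : ℕ) * Real.log q ^ ((5 : ℝ) / 2)) := by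
  obtain ⟨C, hC, hP⟩ := h
  refine ⟨C, hC, fun q _ hq hodd χ hprim hquad hoddχ K _ _ h2 hdisc ψ T S t' hT _ hS => ?_⟩
  have hq5 : (5 : ℝ) ≤ q := by exact_mod_cast hq
  have hq65 : (2 : ℝ) ≤ (q : ℝ) ^ (65 : ℕ) :=
    calc (2 : ℝ) ≤ q := by linarith
      _ = (q : ℝ) ^ 1 := (pow_one _).symm
      _ ≤ (q : ℝ) ^ (65 : ℕ) := pow_le_pow_right₀ (by linarith) (by norm_num)
  exact hP q hq hodd χ hprim hquad hoddχ K h2 hdisc ψ T S t' (hq65.trans hT) hS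

/-! ### Proposition 9.2 as printed, from Proposition 9.1 and the (9.11) claim -/

/-- **Proposition 9.1 ⟹ Proposition 9.2 (as printed)**, given the printed cosmetic claim of (9.11)
as hypothesis `hLq`: "if `(log T)L(1,χ)^{1/2}(log q)^3 ≤ 1` then `ℒ(T) ≪ L(1,χ) log q`"
(p. 20, L71–78). HONEST LABEL for `hLq`: equivalent to `|L′(1,χ)| ≪ log q` for the real primitive
character in the regime `L(1,χ) ≤ (log q)^{−6}(log T)^{−2}`; not in print, OPEN (Friedlander–Iwaniec
2018, (1.4) and Thm 2; Montgomery–Vaughan MNT I, Ex. 11.2.1.3); vacuous unless `χ` is a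
near-Siegel-zero character. Everything else is kernel: Lemma 7.5 (`two_mul_log_mul_sincTerm_le`),
the mean square of `M` (`sum_norm_shortInvSum_sq_le`), the dyadic union (`dyadic_union`).
[cite: ConreyIwaniec2002, Proposition 9.2 (9.12)] -/
theorem conreyIwaniec2002_proposition92_of_proposition91 (h91 : conreyIwaniec2002_proposition91)
    (hLq : ∃ C : ℝ, 0 < C ∧
      ∀ (q : ℕ) [NeZero q], 4 < q → ∀ χ : DirichletCharacter ℂ q,
        χ.IsPrimitive → χ.IsQuadratic → χ.Odd → ∀ T : ℝ, 2 ≤ T →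
          Real.log T * Real.sqrt ‖χ.LFunction 1‖ * Real.log q ^ (3 : ℕ) ≤ 1 →
            calL χ T ≤ C * (‖χ.LFunction 1‖ * Real.log q)) :
    conreyIwaniec2002_proposition92 := by
  -- `hLq` in the exponent-`e` form with `e = 3`
  have h4 : ∃ C : ℝ, 0 < C ∧
      ∀ (q : ℕ) [NeZero q], 4 < q → ∀ χ : DirichletCharacter ℂ q,
        χ.IsPrimitive → χ.IsQuadratic → χ.Odd → ∀ T : ℝ, 2 ≤ T →
          Real.log T * Real.sqrt ‖χ.LFunction 1‖ * Real.log q ^ (3 : ℝ) ≤ 1 →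
            calL χ T ≤ C * (‖χ.LFunction 1‖ * Real.log q ^ (2 * (3 : ℝ) - 5)) := by
    obtain ⟨C, hC, h⟩ := hLq
    refine ⟨C, hC, fun q _ hq χ hprim hquad hodd T hT hsm => ?_⟩
    have e3 : Real.log q ^ (3 : ℝ) = Real.log q ^ (3 : ℕ) := by
      rw [← Real.rpow_natCast]; norm_num
    have e1 : Real.log q ^ (2 * (3 : ℝ) - 5) = Real.log q := by norm_num
    rw [e1]
    rw [e3] at hsm
    exact h q hq χ hprim hquad hodd T hT hsm
  obtain ⟨C, hC, h⟩ := principalEstimate_of 3 (prop91_large_of_proposition91 h91) h4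
  refine ⟨C, hC, fun q _ hq hodd χ hprim hquad hoddχ K _ _ hK hdisc ψ T S t' hT hS => ?_⟩
  have := h q hq hodd χ hprim hquad hoddχ K hK hdisc ψ T S t' hT hS
  have e3 : Real.log q ^ (3 : ℝ) = Real.log q ^ (3 : ℕ) := by
    rw [← Real.rpow_natCast]; norm_num
  rw [e3] at this
  exact this

/-! ### The fact-free variant: Proposition 9.2 with `(log q)^{7/2}` -/

/-- `χ` odd is not the trivial character. [folklore] -/
private theorem ne_one_of_odd {q : ℕ} [NeZero q] {χ : DirichletCharacter ℂ q} (hodd : χ.Odd) :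
    χ ≠ 1 := by
  intro h
  have h1 : χ (-1) = -1 := hodd
  rw [h, MulChar.one_apply (isUnit_one.neg)] at h1
  norm_num at h1

/-- **The textbook replacement of the cosmetic step (9.11):** if
`(log T)L(1,χ)^{1/2}(log q)^{7/2} ≤ 1` (so `L(1,χ) log T ≤ 1`) then
`ℒ(T) = L(1,χ)(L(1,χ)log T + |L′(1,χ)|) ≤ C L(1,χ)(log q)²`, from `|L′(1,χ)| ≪ (log q)²`
(tree `DirichletAbel.norm_deriv_LFunction_ofReal_le`) and `L(1,χ) ≤ log q` (tree
`DirichletAbel.norm_LFunction_one_le_log`). [cite: ConreyIwaniec2002, §9 (9.11)] -/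
theorem ConreyIwaniec2002.calL_le_of_small_weak :
    ∃ C : ℝ, 0 < C ∧
      ∀ (q : ℕ) [NeZero q], 4 < q → ∀ χ : DirichletCharacter ℂ q,
        χ.IsPrimitive → χ.IsQuadratic → χ.Odd → ∀ T : ℝ, 2 ≤ T →
          Real.log T * Real.sqrt ‖χ.LFunction 1‖ * Real.log q ^ ((7 : ℝ) / 2) ≤ 1 →
            calL χ T ≤ C * (‖χ.LFunction 1‖ * Real.log q ^ (2 * ((7 : ℝ) / 2) - 5)) := by
  refine ⟨30, by norm_num, fun q _ hq χ hprim _ hodd T hT hsm => ?_⟩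
  have e2 : Real.log q ^ (2 * ((7 : ℝ) / 2) - 5) = Real.log q ^ (2 : ℕ) := by
    rw [← Real.rpow_natCast]; norm_num
  rw [e2]
  have hq2 : 2 ≤ q := by omega
  have hq5 : (5 : ℝ) ≤ q := by exact_mod_cast hq
  have hq0 : (0 : ℝ) < q := by linarith
  have hℓ1 : 1 ≤ Real.log q := by
    rw [Real.le_log_iff_exp_le (by linarith)]
    exact Real.exp_one_lt_d9.le.trans (by linarith)
  set ℓ : ℝ := Real.log q with hℓdef
  have hℓ0 : 0 < ℓ := by linarith
  set L1 : ℝ := ‖χ.LFunction 1‖ with hL1def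
  have hL10 : 0 ≤ L1 := norm_nonneg _
  have hLT : 0 < Real.log T := Real.log_pos (by linarith)
  -- `L(1,χ) ≤ log q`
  have hL1le : L1 ≤ ℓ := DirichletAbel.norm_LFunction_one_le_log χ (ne_one_of_odd hodd)
  -- `L(1,χ) log T ≤ 1`: `L log T = √L (√L log T) ≤ √ℓ · ℓ^{-7/2} ≤ 1`
  have hsqL : Real.sqrt L1 ≤ ℓ := by
    calc Real.sqrt L1 ≤ Real.sqrt ℓ := Real.sqrt_le_sqrt hL1le
      _ ≤ Real.sqrt ℓ * Real.sqrt ℓ := le_mul_of_one_le_right (Real.sqrt_nonneg _)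
          (by rw [show (1 : ℝ) = Real.sqrt 1 by simp]; exact Real.sqrt_le_sqrt hℓ1)
      _ = ℓ := Real.mul_self_sqrt hℓ0.le
  have hℓ72 : ℓ ≤ ℓ ^ ((7 : ℝ) / 2) := by
    calc ℓ = ℓ ^ (1 : ℝ) := (Real.rpow_one ℓ).symm
      _ ≤ ℓ ^ ((7 : ℝ) / 2) := Real.rpow_le_rpow_of_exponent_le hℓ1 (by norm_num)
  have hLlogT : L1 * Real.log T ≤ 1 := by
    have hss : Real.sqrt L1 * Real.sqrt L1 = L1 := Real.mul_self_sqrt hL10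
    have h1 : L1 * Real.log T = Real.sqrt L1 * (Real.log T * Real.sqrt L1) := by
      linear_combination (-Real.log T) * hss
    have h2 : Real.log T * Real.sqrt L1 * ℓ ≤ Real.log T * Real.sqrt L1 * ℓ ^ ((7 : ℝ) / 2) := by
      have : 0 ≤ Real.log T * Real.sqrt L1 := by positivity
      exact mul_le_mul_of_nonneg_left hℓ72 this
    calc L1 * Real.log T = Real.sqrt L1 * (Real.log T * Real.sqrt L1) := h1
      _ ≤ ℓ * (Real.log T * Real.sqrt L1) := by gcongr
      _ = Real.log T * Real.sqrt L1 * ℓ := by ring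
      _ ≤ 1 := h2.trans hsm
  -- `|L′(1,χ)| ≤ 17 (log q)²` from the explicit Pólya–Vinogradov bound at `σ = 1`
  have hderiv : ‖deriv χ.LFunction 1‖ ≤ 19 * ℓ ^ (2 : ℕ) := by
    have h := DirichletAbel.norm_deriv_LFunction_ofReal_le χ hq2 hprim one_pos le_rfl
    set N : ℕ := ⌈Real.sqrt q * (1 + Real.log q)⌉₊ with hNdef
    have hB0 : 0 < Real.sqrt q * (1 + Real.log q) := by positivity
    have hNpos : (0 : ℝ) < N := by exact_mod_cast Nat.ceil_pos.2 hB0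
    -- `log N ≤ 3 log q`
    have hlogN : Real.log N ≤ 3 * ℓ := by
      have hN : (N : ℝ) ≤ Real.sqrt q * (1 + ℓ) + 1 := (Nat.ceil_lt_add_one hB0.le).le
      have hs : Real.sqrt q ≤ q := by
        rw [Real.sqrt_le_left hq0.le]; nlinarith
      have hℓq : ℓ ≤ q := (Real.log_le_sub_one_of_pos hq0).trans (by linarith)
      have hN3 : (N : ℝ) ≤ (q : ℝ) ^ 3 := by nlinarith [mul_le_mul hs (show 1 + ℓ ≤ 1 + q by linarith) (by positivity) hq0.le]
      calc Real.log N ≤ Real.log ((q : ℝ) ^ 3) := Real.log_le_log hNpos hN3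
        _ = 3 * ℓ := by rw [Real.log_pow]; push_cast; ring
    have hlogN0 : 0 ≤ Real.log N := Real.log_nonneg (by exact_mod_cast Nat.ceil_pos.2 hB0)
    have hlog2 : Real.log 2 < 1 := by linarith [Real.log_two_lt_d9]
    have hlog20 : 0 < Real.log 2 := Real.log_pos one_lt_two
    simp only [Complex.ofReal_one, sub_self, Real.rpow_zero, one_mul, div_one, one_pow] at h
    have hc : 1 + Real.log 2 ≤ 2 := by linarith
    calc ‖deriv χ.LFunction 1‖
        ≤ Real.log N ^ 2 / 2 + (1 + Real.log 2) * Real.log N + (1 + Real.log 2) +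
          ((1 + Real.log 2) + Real.log N) + 1 := by simpa using h
      _ ≤ (3 * ℓ) ^ 2 / 2 + 2 * (3 * ℓ) + 2 + (2 + 3 * ℓ) + 1 := by
          gcongr
      _ ≤ 19 * ℓ ^ (2 : ℕ) := by
          have hℓsq : ℓ ≤ ℓ ^ 2 := by nlinarith
          nlinarith
  -- assemble
  unfold calL
  rw [← hL1def, ← hℓdef] at *
  calc L1 * (L1 * Real.log T + ‖deriv χ.LFunction 1‖)
      ≤ L1 * (1 + 19 * ℓ ^ (2 : ℕ)) := by gcongr
    _ ≤ L1 * (30 * ℓ ^ (2 : ℕ)) := by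
        gcongr
        have : (1 : ℝ) ≤ ℓ ^ 2 := by nlinarith
        nlinarith
    _ = 30 * (L1 * ℓ ^ (2 : ℕ)) := by ring

/-- **Proposition 9.2 with `(log q)^{7/2}` from Proposition 9.1 alone (FACT-FREE variant).** For
`q > 4` odd, `χ` the odd primitive quadratic character mod `q`, `K = ℚ(√−q)`, `ψ ∈ Ĉℓ(K)`,
`1`-spaced `S ⊂ [2, T]`, companions `t′`:
`Σ_{t∈S}|sinc((t−t′)log t)| ≤ C(T(log q)^6/log T + T(log T)L(1,χ)^{1/2}(log q)^{7/2} + ((log q)^{5/2}/log T)(TΣ|ℓ(s)|²)^{1/2})`.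
This is (9.12) with the cosmetic step (9.11) carried out with the textbook `|L′(1,χ)| ≪ (log q)²`
instead of the unproved `≪ log q`; it is the version of the principal estimate that the typed
Proposition 9.1 actually yields. [cite: ConreyIwaniec2002, Proposition 9.2 (9.12)] -/
theorem conreyIwaniec2002_proposition92_weak_of_proposition91
    (h91 : conreyIwaniec2002_proposition91) :
    ∃ C : ℝ, 0 < C ∧
    ∀ (q : ℕ) [NeZero q], 4 < q → Odd q → ∀ χ : DirichletCharacter ℂ q,
      χ.IsPrimitive → χ.IsQuadratic → χ.Odd →
        ∀ (K : Type) [Field K] [NumberField K],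
          Module.finrank ℚ K = 2 → NumberField.discr K = -(q : ℤ) →
            ∀ (ψ : ClassGroup (𝓞 K) →* ℂˣ) (T : ℝ) (S : Finset ℝ) (t' : ℝ → ℝ),
              2 ≤ T → IsPointSet S T →
                ∑ t ∈ S, sincTerm t (t' t) ≤
                  C * (T / Real.log T * Real.log q ^ (6 : ℕ) +
                    T * Real.log T * Real.sqrt ‖χ.LFunction 1‖ * Real.log q ^ ((7 : ℝ) / 2) +
                    Real.log q ^ ((5 : ℝ) / 2) / Real.log T *
                      Real.sqrt (T * ∑ t ∈ S, ‖dividedDifference (classGroupLFunction K ψ)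
                        (1 / 2 + t * I) (1 / 2 + t' t * I)‖ ^ 2)) :=
  principalEstimate_of ((7 : ℝ) / 2) (prop91_large_of_proposition91 h91) calL_le_of_small_weak

end Literature.NumberTheory.LFunctions

end
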